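import Mathlib.Analysis.SpecialFunctions.Trigonometric.Bounds
import Literature.MathematicalPhysics.QuantumLattice.LiebWuFiniteBCutoffSource
import Literature.MathematicalPhysics.QuantumLattice.LiebWuFillingContinuity
import Literature.MathematicalPhysics.QuantumLattice.LiebWuRho0Bounds
import HarnessLib

/-!
# Lieb–Wu 2003, §7.1 (chemical potential from the integral equations), first half:
# the filling near half filling, `N/N_a ≈ 1 + 2a(ρ₀(0) - 1/π)`, eq. (en)

E. H. Lieb, F. Y. Wu, *The one-dimensional Hubbard model: a reminiscence*, Physica A 321 (2003) 1–27
(arXiv:cond-mat/0207529), §7 defines the chemical potentials `μ₊`/`μ₋` of the half-filled chain as the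
one-sided derivatives of the ground-state energy with respect to the particle number and computes `μ₋` in
§7.1 "from the integral equations by doing perturbation theory at the half-filling point": with `B = ∞`
and `Q = π - a`, `a` small,

> `N/N_a = ∫_{-Q}^{Q} ρ = 2∫₀^a ρ + 2∫_a^{π-a} (1/2π) = 2∫₀^a ρ + (π - 2a)/π ≈ 1 + 2a(ρ₀(0) - 1/π)`  (en)
> "In the last expression we used the fact … that `ρ` is continuous in `k` and `a` …; therefore, we can
> replace `∫₀^a ρ` by `a ρ₀(0)` to leading order in `a`. We learn from (en) that
> `δN/N_a = 2a(ρ₀(0) - 1/π) < 0`."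

(`ρ₀` = the half-filled density (19) of PRL 20 (1968) 1445, `liebWuRho0`; `ρ` = the density of the
`B = ∞` solution with cutoff `Q`, `liebWuRhoAt U Q`; `N/N_a` = `liebWuFillingAtCutoff U Q`.) This file
proves (en) with an explicit second-order remainder and draws the consequence that the filling, as a
function of the cutoff, is differentiable from the left at `Q = π` with derivative `2(1/π - ρ₀(0)) > 0`:

* `abs_liebWuFillingAtCutoff_sub_linear_le`: for `U > 0` there is `C` with
  `|N/N_a(Q) - 1 - (Q - π)·(2/π - 2ρ₀(0))| ≤ C (π - Q)²` for all `Q ∈ [π - 1, π]`;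
* `hasDerivWithinAt_liebWuFillingAtCutoff_pi`:
  `HasDerivWithinAt (liebWuFillingAtCutoff U) (2/π - 2ρ₀(0)) (Iic π) π`;
* `deriv_liebWuFillingAtCutoff_pi_pos`: `0 < 2/π - 2ρ₀(0)` (Lemma 5, `ρ₀(0) < 1/π`), i.e. `δN < 0` for
  `a > 0` as printed.

The companion file `LiebWuChemicalPotentialEnergy.lean` does the same for the energy (eq. (finaldeltae))
and `LiebWuChemicalPotentialDerivative.lean` takes the quotient (eq. (mmu): `μ₋ = 2 - 4∫₀^∞ J₁/(ω(1+e^{ωU/2}))`).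

## Proof (the printed one, with the tree's `B = ∞` machinery)

In the rapidity picture of §5 the filling is `N/N_a = Q/π + ∫_{-sin Q}^{sin Q} G_Q`
(`liebWuFilling_liebWuRhoAtS_eq`; `G_Q = σ_Q ∗ K_{U/4}`, `ρ_Q(k) = 1/2π + cos k · G_Q(sin k)`), which is the
printed split `2∫₀^a ρ + (π - 2a)/π` after `x = sin k` (the odd part of `ρ - 1/2π` about `π/2` drops out).
With `a = sin Q = sin(π - Q)`: `∫_{-a}^{a} G_Q = 2a G_π(0) + O(a(π - Q) + a²)` because
(i) `|G_Q - G_π| ≤ (πc)⁻¹ ∫|σ_Q - σ_π| = O(π - Q)` uniformly (`integral_abs_liebWuSigmaAt_sub_le`, the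
`L¹`-Lipschitz continuity of `Q ↦ σ_Q` from the contraction `‖Ŵ‖ ≤ ½`) — this is "ρ is continuous in k
and a"; (ii) `G_π` is Lipschitz (the Cauchy kernel is, `abs_cauchyDensity_sub_le`); and
`G_π(0) = ρ₀(0) - 1/2π` (`liebWuRhoAt_pi`), `|sin(π - Q) - (π - Q)| ≤ (π - Q)³/6`. Collecting terms gives (en)
with an `O((π - Q)²)` remainder, hence the one-sided derivative.

No named facts; all statements proved.

## References

* E. H. Lieb, F. Y. Wu, Physica A 321 (2003) 1–27 = arXiv:cond-mat/0207529, §7 and §7.1, eq. (en)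
  [LiebWuPhysicaA2003].
* E. H. Lieb, F. Y. Wu, Phys. Rev. Lett. 20 (1968) 1445, eqs. (15), (19), (21) [LiebWuPRL1968].
-/

noncomputable section

open MeasureTheory Set Real Filter intervalIntegral Asymptotics
open Literature.Analysis.SpecialFunctions Literature.Analysis.FunctionSpaces
open scoped Topology Interval

namespace Literature.MathematicalPhysics.QuantumLattice

variable {U Q Q' : ℝ}

/-! ### The Cauchy kernel is Lipschitz -/

/-- `|K_c(x) - K_c(x')| ≤ |x - x'|/(π c²)` for the Cauchy density `K_c(x) = c/(π(c² + x²))`, `c > 0`.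
[folklore] -/
private theorem abs_cauchyDensity_sub_le {c : ℝ} (hc : 0 < c) (x x' : ℝ) :
    |cauchyDensity c x - cauchyDensity c x'| ≤ |x - x'| / (π * c ^ 2) := by
  have hπ := Real.pi_pos
  have h1 : 0 < c ^ 2 + x ^ 2 := by positivity
  have h2 : 0 < c ^ 2 + x' ^ 2 := by positivity
  have hsub : cauchyDensity c x - cauchyDensity c x' =
      c * ((x' - x) * (x' + x)) / (π * ((c ^ 2 + x ^ 2) * (c ^ 2 + x' ^ 2))) := by
    rw [cauchyDensity, cauchyDensity]
    field_simp
    ring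
  -- `c³ |x + x'| ≤ (c² + x²)(c² + x'²)`
  have hkey : c ^ 3 * |x' + x| ≤ (c ^ 2 + x ^ 2) * (c ^ 2 + x' ^ 2) := by
    have hx : 2 * c * |x| ≤ c ^ 2 + x ^ 2 := by nlinarith [sq_nonneg (c - |x|), sq_abs x, abs_nonneg x]
    have hx' : 2 * c * |x'| ≤ c ^ 2 + x' ^ 2 := by
      nlinarith [sq_nonneg (c - |x'|), sq_abs x', abs_nonneg x']
    have htri : |x' + x| ≤ |x'| + |x| := abs_add_le _ _
    have hc2 : 0 < c ^ 2 := by positivity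
    calc c ^ 3 * |x' + x| ≤ c ^ 3 * (|x'| + |x|) := by gcongr
      _ = c ^ 2 / 2 * (2 * c * |x'|) + c ^ 2 / 2 * (2 * c * |x|) := by ring
      _ ≤ c ^ 2 / 2 * (c ^ 2 + x' ^ 2) + c ^ 2 / 2 * (c ^ 2 + x ^ 2) := by gcongr
      _ ≤ (c ^ 2 + x ^ 2) * (c ^ 2 + x' ^ 2) := by nlinarith [sq_nonneg x, sq_nonneg x', sq_nonneg (x * x')]
  rw [hsub, abs_div, abs_of_pos (by positivity : 0 < π * ((c ^ 2 + x ^ 2) * (c ^ 2 + x' ^ 2))),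
    abs_mul, abs_of_pos hc, abs_mul, div_le_div_iff₀ (by positivity) (by positivity), abs_sub_comm x x']
  calc c * (|x' - x| * |x' + x|) * (π * c ^ 2) = |x' - x| * π * (c ^ 3 * |x' + x|) := by ring
    _ ≤ |x' - x| * π * ((c ^ 2 + x ^ 2) * (c ^ 2 + x' ^ 2)) := by gcongr
    _ = |x' - x| * (π * ((c ^ 2 + x ^ 2) * (c ^ 2 + x' ^ 2))) := by ring

/-! ### `G_Q = σ_Q ∗ K` at `B = ∞`: dependence on `Q` and on the argument -/

/-- Integrability of `t ↦ h(t) K(x - t)` for `h ∈ L¹`. [folklore] -/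
private theorem integrable_mul_cauchyDensity_sub {h : ℝ → ℝ} (hU : 0 < U) (hh : Integrable h) (x : ℝ) :
    Integrable fun t => h t * cauchyDensity (U / 4) (x - t) := by
  have hc : 0 < U / 4 := by positivity
  exact hh.mul_bdd ((continuous_cauchyDensity hc).comp (continuous_const.sub continuous_id)).aestronglyMeasurable
    (Eventually.of_forall fun t => by
      rw [Real.norm_eq_abs, abs_of_pos (cauchyDensity_pos hc _)]; exact cauchyDensity_le hc _)

/-- **"ρ is continuous in a", quantitatively:** `|G_Q(x) - G_{Q'}(x)| ≤ (π U/4)⁻¹ ∫|σ_Q - σ_{Q'}|`.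
[cite: LiebWuPhysicaA2003, §7.1] -/
theorem abs_liebWuG_univ_sub_le (hU : 0 < U) (hQ : 0 < Q) (hQ' : 0 < Q') (x : ℝ) :
    |liebWuG U Q univ x - liebWuG U Q' univ x| ≤
      1 / (π * (U / 4)) * ∫ t, |liebWuSigmaAt U Q t - liebWuSigmaAt U Q' t| := by
  have hc : 0 < U / 4 := by positivity
  have hσi := integrable_liebWuSigmaAt hU hQ
  have hσ'i := integrable_liebWuSigmaAt hU hQ'
  rw [liebWuG_univ, liebWuG_univ, ← integral_sub (integrable_mul_cauchyDensity_sub hU hσi x)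
    (integrable_mul_cauchyDensity_sub hU hσ'i x)]
  have e : (fun t => liebWuSigmaAt U Q t * cauchyDensity (U / 4) (x - t) -
      liebWuSigmaAt U Q' t * cauchyDensity (U / 4) (x - t)) =
      fun t => (liebWuSigmaAt U Q t - liebWuSigmaAt U Q' t) * cauchyDensity (U / 4) (x - t) := by
    funext t; ring
  rw [e, ← MeasureTheory.integral_const_mul]
  refine (MeasureTheory.abs_integral_le_integral_abs).trans (integral_mono_of_nonneg
    (Eventually.of_forall fun t => abs_nonneg _)
    (((hσi.sub hσ'i).abs).const_mul _) (Eventually.of_forall fun t => ?_))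
  dsimp only
  rw [abs_mul, abs_of_pos (cauchyDensity_pos hc _), mul_comm (1 / (π * (U / 4)))]
  exact mul_le_mul_of_nonneg_left (cauchyDensity_le hc _) (abs_nonneg _)

/-- **"ρ is continuous in k", quantitatively:** `G_Q` is Lipschitz,
`|G_Q(x) - G_Q(x')| ≤ |x - x'| (π(U/4)²)⁻¹ ∫σ_Q`. [cite: LiebWuPhysicaA2003, §7.1] -/
theorem abs_liebWuG_univ_sub_le_mul (hU : 0 < U) (hQ : 0 < Q) (x x' : ℝ) :
    |liebWuG U Q univ x - liebWuG U Q univ x'| ≤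
      |x - x'| / (π * (U / 4) ^ 2) * ∫ t, liebWuSigmaAt U Q t := by
  have hc : 0 < U / 4 := by positivity
  have hσi := integrable_liebWuSigmaAt hU hQ
  have hσ0 : ∀ t, 0 ≤ liebWuSigmaAt U Q t := fun t => (liebWuSigmaAt_pos hU hQ t).le
  rw [liebWuG_univ, liebWuG_univ, ← integral_sub (integrable_mul_cauchyDensity_sub hU hσi x)
    (integrable_mul_cauchyDensity_sub hU hσi x')]
  have e : (fun t => liebWuSigmaAt U Q t * cauchyDensity (U / 4) (x - t) -
      liebWuSigmaAt U Q t * cauchyDensity (U / 4) (x' - t)) =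
      fun t => liebWuSigmaAt U Q t * (cauchyDensity (U / 4) (x - t) - cauchyDensity (U / 4) (x' - t)) := by
    funext t; ring
  rw [e, ← MeasureTheory.integral_const_mul]
  refine (MeasureTheory.abs_integral_le_integral_abs).trans (integral_mono_of_nonneg
    (Eventually.of_forall fun t => abs_nonneg _)
    (hσi.const_mul _) (Eventually.of_forall fun t => ?_))
  dsimp only
  rw [abs_mul, abs_of_nonneg (hσ0 t), mul_comm (|x - x'| / (π * (U / 4) ^ 2))]
  refine mul_le_mul_of_nonneg_left ?_ (hσ0 t)
  have h := abs_cauchyDensity_sub_le hc (x - t) (x' - t)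
  rwa [show x - t - (x' - t) = x - x' by ring] at h

/-- `G_π(0) = ρ₀(0) - 1/2π` (`ρ_π = ρ₀`, eq. (19), at `k = 0`). [cite: LiebWuPRL1968, eq. (19)] -/
theorem liebWuG_univ_pi_zero (hU : 0 < U) :
    liebWuG U π univ 0 = liebWuRho0 U 0 - 1 / (2 * π) := by
  have h := liebWuRhoAt_pi hU (k := 0) ⟨by linarith [Real.pi_pos], Real.pi_pos.le⟩
  rw [liebWuRhoAt, Real.cos_zero, Real.sin_zero, one_mul] at h
  rw [liebWuG_univ, ← h]
  simp only [zero_sub]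
  ring_nf

/-- `∫σ_π = 1/2` (`2M = N = N_a` at `Q = π`). [cite: LiebWuPRL1968, statement (b)] -/
theorem integral_liebWuSigmaAt_pi (hU : 0 < U) : ∫ t, liebWuSigmaAt U π t = 1 / 2 := by
  have h := liebWuFillingAtCutoff_eq_two_mul_integral hU Real.pi_pos le_rfl
  rw [liebWuFillingAtCutoff_pi hU] at h
  linarith

/-- The filling through `G`: `N/N_a = Q/π + ∫_{-sin Q}^{sin Q} G_Q` (`B = ∞`).
[cite: LiebWuPhysicaA2003, §7.1, eq. (en)] -/
theorem liebWuFillingAtCutoff_eq_add_integral_G (hU : 0 < U) (hQ : 0 < Q) :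
    liebWuFillingAtCutoff U Q = Q / π + ∫ x in -Real.sin Q..Real.sin Q, liebWuG U Q univ x := by
  rw [liebWuFillingAtCutoff, ← liebWuRhoAtS_univ]
  exact liebWuFilling_liebWuRhoAtS_eq hU hQ MeasurableSet.univ

/-! ### Eq. (en) with a second-order remainder -/

/-- **Lieb–Wu 2003, eq. (en), quantitative form.** For `U > 0` there is a constant `C` such that for all
cutoffs `Q ∈ [π - 1, π]`
`|N/N_a(Q) - 1 - (Q - π)(2/π - 2ρ₀(0))| ≤ C (π - Q)²`,
i.e. `N/N_a ≈ 1 + 2a(ρ₀(0) - 1/π)`, `a = π - Q`, with an `O(a²)` error. [cite: LiebWuPhysicaA2003, §7.1, eq. (en)] -/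
theorem abs_liebWuFillingAtCutoff_sub_linear_le (hU : 0 < U) :
    ∃ C : ℝ, ∀ Q ∈ Icc (π - 1) π,
      |liebWuFillingAtCutoff U Q - 1 - (Q - π) * (2 / π - 2 * liebWuRho0 U 0)| ≤ C * (π - Q) ^ 2 := by
  have hπ := Real.pi_pos
  have hπ3 : 3 < π := Real.pi_gt_three
  set c : ℝ := U / 4 with hc_def
  have hc : 0 < c := by positivity
  -- the constants
  set B₁ : ℝ := 1 / (π * c) * (1 / π + 8 / (π * U)) with hB₁
  set L : ℝ := 1 / (π * c ^ 2) * (1 / 2) with hL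
  set G0 : ℝ := liebWuG U π univ 0 with hG0_def
  have hG0 : 0 ≤ G0 := (liebWuG_props hU hπ MeasurableSet.univ).2.1 0
  refine ⟨2 * B₁ + 2 * L + 2 * G0 / 6, fun Q hQI => ?_⟩
  obtain ⟨hQ1, hQπ⟩ := hQI
  have hQ : 0 < Q := by linarith
  set x : ℝ := π - Q with hx_def
  have hx0 : 0 ≤ x := by linarith
  have hx1 : x ≤ 1 := by linarith
  set a : ℝ := Real.sin Q with ha_def
  have ha_eq : a = Real.sin x := by rw [ha_def, hx_def, Real.sin_pi_sub]
  have ha0 : 0 ≤ a := by rw [ha_eq]; exact Real.sin_nonneg_of_nonneg_of_le_pi hx0 (by linarith)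
  have hax : a ≤ x := by rw [ha_eq]; exact Real.sin_le hx0
  have hxa : x - a ≤ x ^ 3 / 6 := by
    rcases eq_or_lt_of_le hx0 with h | h
    · rw [← h] at ha_eq ⊢; simp [ha_eq]
    · have := Real.sin_gt_sub_cube h; rw [ha_eq]; linarith
  -- the filling formula and `G_π(0)`
  have hfill := liebWuFillingAtCutoff_eq_add_integral_G hU hQ
  have hGπ0 : G0 = liebWuRho0 U 0 - 1 / (2 * π) := liebWuG_univ_pi_zero hU
  -- Step 1: rewrite the quantity as `∫_{-a}^{a} (G_Q - G_π(0)) + 2(a - x) G_π(0)`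
  have hGc : Continuous (liebWuG U Q univ) := (liebWuG_props hU hQ MeasurableSet.univ).1
  have hkey : liebWuFillingAtCutoff U Q - 1 - (Q - π) * (2 / π - 2 * liebWuRho0 U 0) =
      (∫ y in -a..a, (liebWuG U Q univ y - G0)) + 2 * (a - x) * G0 := by
    rw [intervalIntegral.integral_sub (hGc.intervalIntegrable _ _) intervalIntegrable_const,
      intervalIntegral.integral_const, smul_eq_mul, hfill, hGπ0]
    simp only [hx_def, sub_neg_eq_add]
    field_simp
    ring
  rw [hkey]
  -- Step 2: bound the integrand on `[-a, a]`
  have hD : ∫ t, |liebWuSigmaAt U Q t - liebWuSigmaAt U π t| ≤ x / π + 8 * Q / (π ^ 2 * U) * a := by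
    have h := integral_abs_liebWuSigmaAt_sub_le hU hQ hQπ hπ le_rfl
    rw [Real.sin_pi, sub_zero, abs_of_nonneg ha0, show |Q - π| = x by
      rw [abs_sub_comm]; exact abs_of_nonneg hx0] at h
    exact h
  have hB1x : 1 / (π * c) * (x / π + 8 * Q / (π ^ 2 * U) * a) ≤ B₁ * x := by
    have h8 : 8 * Q / (π ^ 2 * U) * a ≤ 8 / (π * U) * x := by
      have hQa : Q * a ≤ π * x := mul_le_mul hQπ hax ha0 hπ.le
      have : 8 * Q / (π ^ 2 * U) * a = 8 / (π ^ 2 * U) * (Q * a) := by ring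
      rw [this]
      calc 8 / (π ^ 2 * U) * (Q * a) ≤ 8 / (π ^ 2 * U) * (π * x) := by gcongr
        _ = 8 / (π * U) * x := by field_simp
    calc 1 / (π * c) * (x / π + 8 * Q / (π ^ 2 * U) * a)
        ≤ 1 / (π * c) * (x / π + 8 / (π * U) * x) := by gcongr
      _ = B₁ * x := by simp only [hB₁]; ring
  have hbound : ∀ y ∈ Ι (-a) a, ‖liebWuG U Q univ y - G0‖ ≤ B₁ * x + L * x := by
    intro y hy
    have hy' : |y| ≤ a := by
      rw [uIoc_of_le (by linarith : -a ≤ a)] at hy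
      exact abs_le.2 ⟨hy.1.le, hy.2⟩
    rw [Real.norm_eq_abs]
    have h1 : |liebWuG U Q univ y - liebWuG U π univ y| ≤ B₁ * x :=
      (abs_liebWuG_univ_sub_le hU hQ hπ y).trans (le_trans (by gcongr) hB1x)
    have h2 : |liebWuG U π univ y - G0| ≤ L * x := by
      have h := abs_liebWuG_univ_sub_le_mul hU hπ y 0
      rw [integral_liebWuSigmaAt_pi hU, sub_zero] at h
      refine h.trans ?_
      have : |y| / (π * (U / 4) ^ 2) * (1 / 2) = L * |y| := by simp only [hL, hc_def]; ring
      rw [this]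
      exact mul_le_mul_of_nonneg_left (hy'.trans hax) (by positivity)
    calc |liebWuG U Q univ y - G0|
        = |(liebWuG U Q univ y - liebWuG U π univ y) + (liebWuG U π univ y - G0)| := by ring_nf
      _ ≤ |liebWuG U Q univ y - liebWuG U π univ y| + |liebWuG U π univ y - G0| := abs_add_le _ _
      _ ≤ B₁ * x + L * x := add_le_add h1 h2
  have hint : |∫ y in -a..a, (liebWuG U Q univ y - G0)| ≤ (B₁ * x + L * x) * (2 * a) := by
    have h := intervalIntegral.norm_integral_le_of_norm_le_const hbound
    rw [Real.norm_eq_abs, show |a - -a| = 2 * a by rw [sub_neg_eq_add, abs_of_nonneg (by linarith)]; ring] at h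
    exact h
  -- Step 3: collect
  have h2 : |2 * (a - x) * G0| ≤ 2 * G0 / 6 * x ^ 2 := by
    rw [show 2 * (a - x) * G0 = -(2 * G0 * (x - a)) by ring, abs_neg, abs_of_nonneg (by nlinarith)]
    have hx3 : x ^ 3 ≤ x ^ 2 := by nlinarith [sq_nonneg x]
    nlinarith
  calc |(∫ y in -a..a, (liebWuG U Q univ y - G0)) + 2 * (a - x) * G0|
      ≤ |∫ y in -a..a, (liebWuG U Q univ y - G0)| + |2 * (a - x) * G0| := abs_add_le _ _
    _ ≤ (B₁ * x + L * x) * (2 * a) + 2 * G0 / 6 * x ^ 2 := add_le_add hint h2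
    _ ≤ (B₁ * x + L * x) * (2 * x) + 2 * G0 / 6 * x ^ 2 := by gcongr
    _ = (2 * B₁ + 2 * L + 2 * G0 / 6) * x ^ 2 := by ring
    _ = (2 * B₁ + 2 * L + 2 * G0 / 6) * (π - Q) ^ 2 := by rw [hx_def]

/-- **The filling is differentiable from the left at `Q = π`, with derivative `2/π - 2ρ₀(0)`** — the
coefficient of eq. (en): `δN/N_a = 2a(ρ₀(0) - 1/π)`, `a = π - Q`. [cite: LiebWuPhysicaA2003, §7.1, eq. (en)] -/
theorem hasDerivWithinAt_liebWuFillingAtCutoff_pi (hU : 0 < U) :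
    HasDerivWithinAt (liebWuFillingAtCutoff U) (2 / π - 2 * liebWuRho0 U 0) (Iic π) π := by
  obtain ⟨C, hC⟩ := abs_liebWuFillingAtCutoff_sub_linear_le hU
  have hC0 : 0 ≤ C := by
    have h := hC π ⟨by linarith, le_rfl⟩
    rw [sub_self, zero_pow two_ne_zero, mul_zero] at h
    have h' := (abs_nonneg _).trans h
    -- `0 ≤ C * 0` gives nothing; use the point `π - 1` instead
    have h1 := hC (π - 1) ⟨le_rfl, by linarith⟩
    have : (π - (π - 1)) ^ 2 = 1 := by ring
    rw [this, mul_one] at h1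
    exact (abs_nonneg _).trans h1
  rw [hasDerivWithinAt_iff_isLittleO, Asymptotics.isLittleO_iff]
  intro ε hε
  have hδ : 0 < min 1 (ε / (C + 1)) := lt_min one_pos (div_pos hε (by linarith))
  have hmem : Iic π ∩ Ioo (π - min 1 (ε / (C + 1))) (π + 1) ∈ 𝓝[Iic π] π :=
    inter_mem_nhdsWithin _ (Ioo_mem_nhds (a := π - min 1 (ε / (C + 1))) (b := π + 1) (x := π)
      (by linarith) (by linarith))
  filter_upwards [hmem] with Q hQ
  obtain ⟨hQπ, hQ1, -⟩ := hQ
  have hQπ' : Q ≤ π := hQπ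
  have hx0 : 0 ≤ π - Q := by linarith
  have hx1 : π - Q < min 1 (ε / (C + 1)) := by linarith
  have hQI : Q ∈ Icc (π - 1) π := ⟨by linarith [min_le_left 1 (ε / (C + 1))], hQπ'⟩
  have h := hC Q hQI
  rw [liebWuFillingAtCutoff_pi hU, smul_eq_mul]
  rw [Real.norm_eq_abs, Real.norm_eq_abs, show |Q - π| = π - Q by rw [abs_sub_comm]; exact abs_of_nonneg hx0]
  calc |liebWuFillingAtCutoff U Q - 1 - (Q - π) * (2 / π - 2 * liebWuRho0 U 0)|
      ≤ C * (π - Q) ^ 2 := h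
    _ = (C * (π - Q)) * (π - Q) := by ring
    _ ≤ ε * (π - Q) := by
        refine mul_le_mul_of_nonneg_right ?_ hx0
        have hlt : π - Q ≤ ε / (C + 1) := (hx1.le).trans (min_le_right _ _)
        calc C * (π - Q) ≤ C * (ε / (C + 1)) := by gcongr
          _ ≤ ε := by
              rw [mul_div_assoc']
              exact (div_le_iff₀ (by linarith)).2 (by nlinarith)

/-- **`δN/N_a < 0`:** the left derivative `2/π - 2ρ₀(0)` of the filling at `Q = π` is positive, because
`ρ₀(0) < 1/π` (Lieb–Wu 2003, Lemma 5). [cite: LiebWuPhysicaA2003, §7.1, after eq. (en)] -/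
theorem deriv_liebWuFillingAtCutoff_pi_pos (hU : 0 < U) : 0 < 2 / π - 2 * liebWuRho0 U 0 := by
  have h := liebWuRho0_lt_inv_pi hU 0
  have e : (2 : ℝ) / π = 2 * (1 / π) := by ring
  rw [e]
  linarith

end Literature.MathematicalPhysics.QuantumLattice
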